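import Literature.NumberTheory.LFunctions.DeBruijnNewmanUpperBound
import Literature.NumberTheory.LFunctions.DeBruijnHHeatFlow
import Literature.NumberTheory.LFunctions.DeBruijnHLogDerivSeries
import Literature.NumberTheory.LFunctions.EquivalentsProofs
import Literature.Analysis.Complex.ZeroSumVariation
import Literature.Analysis.Complex.RectangleCauchyFormula
import HarnessLib

/-!
# Polymath 15, Proposition 3.3 and Theorem 1.2 — the discharge

Trunk T-ANT (`Literature/NumberTheory/LFunctions`), companion ("Proofs") file of
`DeBruijnNewmanUpperBound.lean`, which vendored Polymath 15's upper bound criterion (Res. Math.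
Sci. 6 (2019), **Thm. 1.2**, `Literature.NumberTheory.LFunctions.Polymath15.upper_bound_criterion`) and its main step
(**Prop. 3.3**, `Literature.NumberTheory.LFunctions.Polymath15.zero_free_region_criterion`) as named facts and proved Thm. 1.2
from Prop. 3.3. Here **Prop. 3.3 is proved** (`Polymath15.zero_free_region_criterion_holds`), hence
**Thm. 1.2** (`Polymath15.upper_bound_criterion_holds`), and Platt–Trudgian's `Λ ≤ 0.2`
(`Literature.NumberTheory.LFunctions.platt_trudgian`) is reduced to its two computational inputs alone
(`Literature.NumberTheory.LFunctions.platt_trudgian_of_numerics`: RH to height `3·10¹²` and Table 1, row 2 of Polymath 15).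

## The proof (Polymath 15, §3, pp. 9–10) and its formalisation

Printed proof of Prop. 3.3: by de Bruijn's Thm. 13 and the critical strip the caps `y ≤ 1`,
`y ≤ √(1 − 2t₀)`, `y ≤ √(1 − 2t)` are automatic; with `Y(t) = √(y₀² + 2(t₀ − t))` it suffices that
for no `t ∈ [0, t₀]` there is a zero of `H_t` in `R(t) = {0 ≤ x ≤ X, y ≥ Y(t)}`; at the minimal bad
time `t₁ ∈ (0, t₀]` (continuity) a zero sits on `∂R(t₁)`, not on `x = X` (barrier (iii)) nor on
`x = 0` (`H_t(iy) > 0`), so at `x + iY(t₁)`, `0 < x < X`; a repeated zero is excluded by the Hermite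
splitting of Prop. 3.1 (ii), and a simple zero `z_j` moves with
`Im ż_j(t₁) = −2 ∑' (Y − y_k)/((x − x_k)² + (Y − y_k)²) < Ẏ(t₁) = −1/Y(t₁)` (Prop. 3.1 (i) and the
pairing of each zero with its conjugate), contradicting minimality.

The formalisation follows this exactly except at the boundary zero `z₁ = x₁ + iY(t₁)`, where the
case distinction simple/repeated (Prop. 3.1 (i)/(ii): implicit function theorem, resp.
Puiseux/Hermite expansion) is replaced by one uniform argument valid for any multiplicity `m`: in a
small rectangle `K ∋ z₁` the zeros of `H_t` (`t` near `t₁`) have constant total multiplicity `m`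
and their weighted sum `c(t) = Σ m_t(ρ) ρ = (1/2πi) ∮_{∂K} w H_t'/H_t dw` (weighted argument
principle, `Literature/Analysis/Complex/WeightedArgumentPrinciple.lean`) is differentiable at `t₁`
with `ċ(t₁) = −(1/2πi)∮_{∂K} Ḣ/H = (1/2πi)∮_{∂K} H''/H = 2m (Q'/Q)(z₁)`
(`Literature/Analysis/Complex/ZeroSumVariation.lean`; the backwards heat equation `Ḣ_t = −H_t''`,
`DeBruijnHHeatFlow.lean`; the residue `rectBoundaryIntegral_deriv_deriv_div` below), where
`H_{t₁} = (w − z₁)^m Q`. The sign computation of the printed proof, run on the Hadamard product of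
`H_{t₁}` (`DeBruijnHLogDerivSeries.lean`, `im_logDeriv_cofactor_lt`), gives
`Im (Q'/Q)(z₁) < −m/(2Y)`, so `Im ċ(t₁) < −m²/Y ≤ −m/Y = m Ẏ(t₁)`; but minimality puts all zeros in
`K` below `Im = Y(t)` for `t < t₁`, so `Im c(t) < m Y(t)` there while `Im c(t₁) = m Y(t₁)`, whence
`d/dt (Im c − mY)(t₁) ≥ 0` — contradiction (`no_minimal_bad`). For `m = 1` this is literally the
printed computation (`ċ = ż_j = H''/H'(z_j) = 2 ∑'_{k ≠ j} 1/(z_j − z_k)`).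

## Contents (all proved)

* symmetries and the imaginary axis: `zero_neg_conj`, `coshTransform_pos`,
  `deBruijnH_I_mul_ne_zero`; the strip: `abs_im_lt_one_of_zero`, `im_le_sqrt_of_zero`;
* `Yfun`, `InRegion`, `Bad`, `isClosed_badSet`, `not_bad_zero`, `barrier_excludes`,
  `not_interior_zero_at_minimal` (Hurwitz, `Literature/Analysis/Complex/Hurwitz.lean`),
  `exists_minimal_bad`;
* `rectBoundaryIntegral_deriv_deriv_div`: `(1/2πi)∮_{∂K} F''/F = 2m (Q'/Q)(z₁)` for
  `F = (w − z₁)^m Q`;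
* `no_minimal_bad`, `not_bad`, **`zero_free_region_criterion_holds`** (Prop. 3.3),
  **`upper_bound_criterion_holds`** (Thm. 1.2), `RH.platt_trudgian_of_numerics`.

## References

* D. H. J. Polymath, *Effective approximation of heat flow evolution of the Riemann `ξ` function,
  and a new upper bound for the de Bruijn–Newman constant*, Res. Math. Sci. 6 (2019), Paper 31
  (arXiv:1904.12438): Thm. 1.2, §3 (Prop. 3.1, Thm. 3.2, Prop. 3.3 and their proofs, pp. 8–10).
* D. J. Platt, T. S. Trudgian, *The Riemann hypothesis is true up to `3·10¹²`*, Bull. Lond. Math.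
  Soc. 53 (2021) 792–797, §3.4, Cor. 2.
* J. B. Conway, *Functions of One Complex Variable I*, 2nd ed., GTM 11, Springer 1978, V.3.6,
  VII.2.5.
-/

noncomputable section

open Complex Filter Topology Set MeasureTheory Metric

namespace Literature.NumberTheory.LFunctions

namespace Polymath15

/-! ## Zeros of `H_t`: symmetries, the imaginary axis, the strip -/

/-- `H_t(−z̄) = conj H_t(z)`: the zero set of `H_t` is symmetric under `z ↦ −z̄`
(`H_t` even and real). [cite: Polymath2019, §3] -/
theorem deBruijnH_neg_conj (t : ℝ) (z : ℂ) :
    deBruijnH t (-(starRingEnd ℂ z)) = starRingEnd ℂ (deBruijnH t z) := by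
  rw [deBruijnH_neg, deBruijnH_conj]

/-- Reflection of zeros in the imaginary axis. [cite: Polymath2019, §3] -/
theorem zero_neg_conj {t : ℝ} {z : ℂ} (hz : deBruijnH t z = 0) :
    deBruijnH t (-(starRingEnd ℂ z)) = 0 := by
  rw [deBruijnH_neg_conj, hz, map_zero]

/-- `H_t(iy) > 0` for real `y`: "from (htdef) and the positivity of `Φ`, we also see that
`H_t(iy) > 0` for all `y ∈ ℝ`, so there are no zeroes on the imaginary axis" (the integrand
`e^{tu²} Φ(u) cosh(yu)` is positive). [cite: Polymath2019, §3] -/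
theorem coshTransform_pos (t y : ℝ) : 0 < Newman.coshTransform t y := by
  unfold Newman.coshTransform
  have hint : IntegrableOn (fun u : ℝ ↦ Real.exp (t * u ^ 2) * deBruijnPhi u * Real.cosh (y * u))
      (Ioi 0) := by
    refine (integrableOn_deBruijnHBound t |y|).mono' ?_
      (ae_restrict_of_forall_mem measurableSet_Ioi fun u hu ↦ ?_)
    · refine ContinuousOn.aestronglyMeasurable ?_ measurableSet_Ioi
      exact ((by fun_prop : Continuous fun u : ℝ ↦ Real.exp (t * u ^ 2)).continuousOn.mul
        (continuousOn_deBruijnPhi_Ici.mono Ioi_subset_Ici_self)).mul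
        (by fun_prop : Continuous fun u : ℝ ↦ Real.cosh (y * u)).continuousOn
    · have hu' : 0 ≤ u := le_of_lt hu
      rw [deBruijnHBound, Real.norm_eq_abs, abs_mul, abs_mul, abs_of_pos (Real.exp_pos _),
        abs_of_pos (Real.cosh_pos _)]
      gcongr
      rw [Real.cosh_eq]
      have h1 : Real.exp (y * u) ≤ Real.exp (|y| * u) :=
        Real.exp_monotone (mul_le_mul_of_nonneg_right (le_abs_self y) hu')
      have h2 : Real.exp (-(y * u)) ≤ Real.exp (|y| * u) :=
        Real.exp_monotone (by rw [← neg_mul]; exact mul_le_mul_of_nonneg_right (neg_le_abs y) hu')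
      linarith
  refine (setIntegral_pos_iff_support_of_nonneg_ae
    (ae_restrict_of_forall_mem measurableSet_Ioi fun u hu ↦ ?_) hint).2 ?_
  · exact (mul_pos (mul_pos (Real.exp_pos _) (deBruijnPhi_pos_of_nonneg (le_of_lt hu)))
      (Real.cosh_pos _)).le
  · have : Function.support (fun u : ℝ ↦ Real.exp (t * u ^ 2) * deBruijnPhi u * Real.cosh (y * u))
        ∩ Ioi 0 = Ioi 0 := by
      refine Set.inter_eq_right.2 fun u hu ↦ ?_
      exact (mul_pos (mul_pos (Real.exp_pos _) (deBruijnPhi_pos_of_nonneg (le_of_lt hu)))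
        (Real.cosh_pos _)).ne'
    rw [this, Real.volume_Ioi]
    exact ENNReal.zero_lt_top

/-- No zeros on the imaginary axis: `H_t(iy) ≠ 0`. [cite: Polymath2019, §3] -/
theorem deBruijnH_I_mul_ne_zero (t y : ℝ) : deBruijnH t (I * y) ≠ 0 := by
  rw [Newman.deBruijnH_I_mul, Ne, Complex.ofReal_eq_zero]
  exact (coshTransform_pos t y).ne'

/-- A zero with real part `0` is impossible. [cite: Polymath2019, §3] -/
theorem re_ne_zero_of_zero {t : ℝ} {z : ℂ} (hz : deBruijnH t z = 0) : z.re ≠ 0 := by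
  intro h0
  have : z = I * z.im := by
    apply Complex.ext <;> simp [h0]
  rw [this] at hz
  exact deBruijnH_I_mul_ne_zero t z.im hz

/-- Every zero of `H_0` has `|Im| < 1` (critical strip), and hence by de Bruijn's Thm. 13 every
zero of `H_t`, `t > 0`, has `|Im z| ≤ √max(1 − 2t, 0)`; in particular `|Im z| < 1` for `t ≥ 0`.
[cite: Polymath2019, §3, (hoz)–(sas)] -/
theorem abs_im_le_sqrt_of_zero {t : ℝ} (ht : 0 < t) {z : ℂ} (hz : deBruijnH t z = 0) :
    |z.im| ≤ Real.sqrt (max (1 - 2 * t) 0) := by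
  have hup : ∀ w : ℂ, deBruijnH 0 w = 0 → w.im ≤ 1 := fun w hw ↦
    (abs_lt.1 (LFunctions.abs_im_lt_one_of_deBruijnH_zero_eq_zero deBruijnH_zero_eq_holds hw)).2.le
  have h1 := de_bruijn_strip_shrinking_holds 0 1 one_pos hup t ht z hz
  have h2 := de_bruijn_strip_shrinking_holds 0 1 one_pos hup t ht _ (deBruijnH_conj_eq_zero hz)
  rw [Complex.conj_im] at h2
  simp only [one_pow, sub_zero] at h1 h2
  exact abs_le.2 ⟨by linarith, h1⟩

/-- Every zero of `H_t`, `t ≥ 0`, has `|Im z| < 1`. [cite: Polymath2019, §3] -/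
theorem abs_im_lt_one_of_zero {t : ℝ} (ht : 0 ≤ t) {z : ℂ} (hz : deBruijnH t z = 0) :
    |z.im| < 1 := by
  rcases ht.eq_or_lt with rfl | ht'
  · exact LFunctions.abs_im_lt_one_of_deBruijnH_zero_eq_zero deBruijnH_zero_eq_holds hz
  · refine (abs_im_le_sqrt_of_zero ht' hz).trans_lt ?_
    rw [Real.sqrt_lt' one_pos, one_pow]
    exact max_lt (by linarith) one_pos

/-- For `t > 0`, a zero of `H_t` with positive imaginary part has `Im z ≤ √(1 − 2t)` and
`1 − 2t ≥ 0`. [cite: Polymath2019, §3] -/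
theorem im_le_sqrt_of_zero {t : ℝ} (ht : 0 < t) {z : ℂ} (hz : deBruijnH t z = 0)
    (hpos : 0 < z.im) : z.im ≤ Real.sqrt (1 - 2 * t) := by
  have h := (le_abs_self _).trans (abs_im_le_sqrt_of_zero ht hz)
  rcases le_or_gt (1 - 2 * t) 0 with hle | hgt
  · rw [max_eq_right hle, Real.sqrt_zero] at h
    linarith
  · rwa [max_eq_left hgt.le] at h

/-! ## The moving lower edge `Y(t) = √(y₀² + 2(t₀ − t))` -/

/-- `Y(t) = √(y₀² + 2(t₀ − t))`. [cite: Polymath2019, Prop. 3.3 (proof)] -/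
def Yfun (t₀ y₀ t : ℝ) : ℝ := Real.sqrt (y₀ ^ 2 + 2 * (t₀ - t))

/-- `Y(t)² = y₀² + 2(t₀ − t)` for `t ≤ t₀`. [folklore] -/
theorem Yfun_sq {t₀ y₀ t : ℝ} (ht : t ≤ t₀) : Yfun t₀ y₀ t ^ 2 = y₀ ^ 2 + 2 * (t₀ - t) :=
  Real.sq_sqrt (by nlinarith [sq_nonneg y₀])

/-- `Y(t) > 0` for `t ≤ t₀` (`y₀ > 0`). [folklore] -/
theorem Yfun_pos {t₀ y₀ t : ℝ} (hy₀ : 0 < y₀) (ht : t ≤ t₀) : 0 < Yfun t₀ y₀ t :=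
  Real.sqrt_pos.2 (by nlinarith [sq_nonneg y₀])

/-- `Y(t₀) = y₀`. [folklore] -/
theorem Yfun_self {t₀ y₀ : ℝ} (hy₀ : 0 ≤ y₀) : Yfun t₀ y₀ t₀ = y₀ := by
  simp [Yfun, Real.sqrt_sq hy₀]

/-- `y₀ ≤ Y(t)` for `t ≤ t₀`. [folklore] -/
theorem le_Yfun {t₀ y₀ t : ℝ} (hy₀ : 0 ≤ y₀) (ht : t ≤ t₀) : y₀ ≤ Yfun t₀ y₀ t := by
  rw [Yfun, Real.le_sqrt hy₀ (by nlinarith [sq_nonneg y₀])]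
  nlinarith

/-- `Y` is non-increasing. [folklore] -/
theorem Yfun_antitone (t₀ y₀ : ℝ) : Antitone (Yfun t₀ y₀) := fun s t hst ↦
  Real.sqrt_le_sqrt (by linarith)

/-- `Y` is continuous. [folklore] -/
theorem continuous_Yfun (t₀ y₀ : ℝ) : Continuous (Yfun t₀ y₀) := by
  unfold Yfun; fun_prop

/-- `Y'(t) = −1/Y(t)` for `t ≤ t₀` (`y₀ > 0`). [cite: Polymath2019, Prop. 3.3 (proof)] -/
theorem hasDerivAt_Yfun {t₀ y₀ t : ℝ} (hy₀ : 0 < y₀) (ht : t ≤ t₀) :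
    HasDerivAt (Yfun t₀ y₀) (-1 / Yfun t₀ y₀ t) t := by
  have hpos : 0 < y₀ ^ 2 + 2 * (t₀ - t) := by nlinarith [sq_nonneg y₀]
  have hin : HasDerivAt (fun s : ℝ ↦ y₀ ^ 2 + 2 * (t₀ - s)) (-2) t := by
    simpa using ((hasDerivAt_id t).const_sub t₀).const_mul (2 : ℝ) |>.const_add (y₀ ^ 2)
  have h := hin.sqrt hpos.ne'
  unfold Yfun
  convert h using 1
  field_simp

/-! ## The region `R(t)` to the left of the barrier and the set of bad times -/

section Barrier

variable {t₀ X y₀ : ℝ}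

/-- `z ∈ R(t)`: `0 ≤ Re z ≤ X` and `Im z ≥ Y(t)`. [cite: Polymath2019, Prop. 3.3 (proof)] -/
def InRegion (t₀ X y₀ t : ℝ) (z : ℂ) : Prop :=
  0 ≤ z.re ∧ z.re ≤ X ∧ Yfun t₀ y₀ t ≤ z.im

/-- `Bad t`: `H_t` has a zero in `R(t)` ("the claim failed for some time `t`").
[cite: Polymath2019, Prop. 3.3 (proof)] -/
def Bad (t₀ X y₀ t : ℝ) : Prop :=
  ∃ z : ℂ, deBruijnH t z = 0 ∧ InRegion t₀ X y₀ t z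

/-- The set of bad times in `[0, t₀]` is closed ("such a time exists because `H_t` varies
continuously in `t`, and there are no zeroes with `y > 1`"): limits of zeros are zeros by joint
continuity, and the zeros in question stay in the compact box `[0, X] × [−1, 1]`.
[cite: Polymath2019, Prop. 3.3 (proof)] -/
theorem isClosed_badSet : IsClosed {t : ℝ | t ∈ Icc 0 t₀ ∧ Bad t₀ X y₀ t} := by
  refine IsSeqClosed.isClosed fun u t hu hut ↦ ?_
  have htI : t ∈ Icc 0 t₀ := isClosed_Icc.mem_of_tendsto hut (Eventually.of_forall fun n ↦ (hu n).1)
  choose z hz using fun n ↦ (hu n).2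
  -- the zeros stay in a compact box
  have hK : IsCompact (Icc 0 X ×ℂ Icc (-1) 1) := isCompact_Icc.reProdIm isCompact_Icc
  have hzK : ∀ n, z n ∈ Icc 0 X ×ℂ Icc (-1) 1 := fun n ↦
    ⟨⟨(hz n).2.1, (hz n).2.2.1⟩,
      (abs_le.1 (abs_im_lt_one_of_zero (hu n).1.1 (hz n).1).le)⟩
  obtain ⟨w, -, φ, hφ, hlim⟩ := hK.tendsto_subseq hzK
  have hut' : Tendsto (u ∘ φ) atTop (𝓝 t) := hut.comp hφ.tendsto_atTop
  refine ⟨htI, w, ?_, ?_, ?_, ?_⟩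
  · -- `H_t(w) = 0` by joint continuity
    have hc : Tendsto (fun n ↦ deBruijnH (u (φ n)) (z (φ n))) atTop (𝓝 (deBruijnH t w)) := by
      have := (continuous_deBruijnH_uncurry.tendsto (t, w)).comp (hut'.prodMk_nhds hlim)
      exact this
    have h0 : (fun n ↦ deBruijnH (u (φ n)) (z (φ n))) = fun _ ↦ 0 := funext fun n ↦ (hz (φ n)).1
    rw [h0, tendsto_const_nhds_iff] at hc
    exact hc.symm
  · exact ge_of_tendsto' ((continuous_re.tendsto w).comp hlim) fun n ↦ (hz (φ n)).2.1
  · exact le_of_tendsto' ((continuous_re.tendsto w).comp hlim) fun n ↦ (hz (φ n)).2.2.1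
  · exact le_of_tendsto_of_tendsto' (((continuous_Yfun t₀ y₀).tendsto t).comp hut')
      ((continuous_im.tendsto w).comp hlim) fun n ↦ (hz (φ n)).2.2.2

/-- Hypothesis (i) of Prop. 3.3 says exactly that `t = 0` is not a bad time (zeros of `H_0` have
`Im < 1`). [cite: Polymath2019, Prop. 3.3 (proof)] -/
theorem not_bad_zero (h₁ : InitialZeroFreeH t₀ X y₀) : ¬Bad t₀ X y₀ 0 := by
  rintro ⟨z, hz, h0, hX, hY⟩
  have h1 : z.im ≤ 1 := (abs_lt.1 (abs_im_lt_one_of_zero le_rfl hz)).2.le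
  have hY' : Real.sqrt (y₀ ^ 2 + 2 * t₀) ≤ z.im := by simpa [Yfun] using hY
  exact h₁ z.re z.im h0 hX hY' h1 (by rw [re_add_im]; exact hz)

/-- The barrier hypothesis (iii) in the form used: for `0 < t ≤ t₀` there is no zero of `H_t`
with `X ≤ Re z ≤ X + √(1 − y₀²)` and `Im z ≥ Y(t)` (the cap `Im z ≤ √(1 − 2t)` is automatic).
[cite: Polymath2019, Prop. 3.3 (proof)] -/
theorem barrier_excludes (h₃ : BarrierZeroFree t₀ X y₀) (hy₀ : 0 < y₀) {t : ℝ} (ht : 0 < t)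
    (ht₀ : t ≤ t₀) {z : ℂ} (hz : deBruijnH t z = 0) (hX : X ≤ z.re)
    (hX' : z.re ≤ X + Real.sqrt (1 - y₀ ^ 2)) (hY : Yfun t₀ y₀ t ≤ z.im) : False := by
  have hpos : 0 < z.im := (Yfun_pos hy₀ ht₀).trans_le hY
  have hcap := im_le_sqrt_of_zero ht hz hpos
  exact h₃ t z.re z.im ht.le ht₀ hX hX' (by simpa [Yfun] using hY) hcap
    (by rw [re_add_im]; exact hz)

/-- **The Rouché/Hurwitz step.** At a minimal bad time `t₁ > 0`, no zero of `H_{t₁}` lies in the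
interior of `R(t₁)`: such a zero would persist (Hurwitz) for `t < t₁` close to `t₁` inside
`R(t)`, contradicting minimality. [cite: Polymath2019, Prop. 3.3 (proof)] -/
theorem not_interior_zero_at_minimal {t₁ : ℝ} (ht₁ : 0 < t₁)
    (hmin : ∀ t, 0 ≤ t → t < t₁ → ¬Bad t₀ X y₀ t) {z : ℂ} (hz : deBruijnH t₁ z = 0)
    (hre : 0 < z.re) (hre' : z.re < X) (him : Yfun t₀ y₀ t₁ < z.im) : False := by
  -- an isolating radius
  have han : AnalyticAt ℂ (deBruijnH t₁) z := (differentiable_deBruijnH_holds t₁).analyticAt z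
  have hiso : ∀ᶠ w in 𝓝[≠] z, deBruijnH t₁ w ≠ 0 := by
    rcases han.eventually_eq_zero_or_eventually_ne_zero with h | h
    · exfalso
      obtain ⟨w₀, hw₀⟩ := exists_deBruijnH_ne_zero t₁
      have hall := ((differentiable_deBruijnH_holds t₁).differentiableOn.analyticOnNhd
        isOpen_univ).eqOn_zero_of_preconnected_of_eventuallyEq_zero isPreconnected_univ
        (mem_univ z) h
      exact hw₀ (hall (mem_univ w₀))
    · exact h
  obtain ⟨r₀, hr₀, hiso'⟩ : ∃ r₀ > 0, ∀ w, dist w z < r₀ → w ≠ z → deBruijnH t₁ w ≠ 0 := by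
    rw [eventually_nhdsWithin_iff, Metric.eventually_nhds_iff] at hiso
    obtain ⟨r₀, hr₀, h⟩ := hiso
    exact ⟨r₀, hr₀, fun w hw hne ↦ h hw hne⟩
  -- the radius
  set r : ℝ := min (min z.re (X - z.re)) (min ((z.im - Yfun t₀ y₀ t₁) / 2) (r₀ / 2)) with hr
  have hr_pos : 0 < r := by
    simp only [hr, lt_min_iff]; exact ⟨⟨hre, by linarith⟩, by linarith, by linarith⟩
  have hr1 : r ≤ z.re := (min_le_left _ _).trans (min_le_left _ _)
  have hr2 : r ≤ X - z.re := (min_le_left _ _).trans (min_le_right _ _)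
  have hr3 : r ≤ (z.im - Yfun t₀ y₀ t₁) / 2 := (min_le_right _ _).trans (min_le_left _ _)
  have hr4 : r ≤ r₀ / 2 := (min_le_right _ _).trans (min_le_right _ _)
  -- Hurwitz
  have hunif : TendstoUniformlyOn (fun t ↦ deBruijnH t) (deBruijnH t₁) (𝓝[<] t₁)
      (closedBall z r) := by
    have hloc := tendstoLocallyUniformlyOn_of_continuous_uncurry (H := deBruijnH)
      continuous_deBruijnH_uncurry t₁ isOpen_univ
    have hu := (tendstoLocallyUniformlyOn_iff_forall_isCompact isOpen_univ).1 hloc (closedBall z r)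
      (subset_univ _) (isCompact_closedBall _ _)
    rw [tendstoUniformlyOn_iff_tendsto] at hu ⊢
    exact hu.mono_left (Filter.prod_mono nhdsWithin_le_nhds le_rfl)
  have hsphere : ∀ w ∈ sphere z r, deBruijnH t₁ w ≠ 0 := by
    intro w hw
    rw [mem_sphere] at hw
    exact hiso' w (by rw [hw]; linarith) (by rintro rfl; rw [dist_self] at hw; linarith)
  have hH := Complex.eventually_exists_zero_mem_ball_of_tendstoUniformlyOn (l := 𝓝[<] t₁)
    (F := fun t ↦ deBruijnH t) hr_pos
    (Eventually.of_forall fun t ↦ (differentiable_deBruijnH_holds t).diffContOnCl)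
    hunif (differentiable_deBruijnH_holds t₁).continuous.continuousOn hz hsphere
  -- nearby times are `≥ 0`, `< t₁`, and `Y(t) < Y(t₁) + r`
  have hev₁ : ∀ᶠ t in 𝓝[<] t₁, 0 ≤ t :=
    eventually_nhdsWithin_of_eventually_nhds (eventually_ge_nhds ht₁)
  have hev₂ : ∀ᶠ t in 𝓝[<] t₁, t < t₁ := self_mem_nhdsWithin
  have hev₃ : ∀ᶠ t in 𝓝[<] t₁, Yfun t₀ y₀ t < Yfun t₀ y₀ t₁ + r := by
    have h3 : Iio (Yfun t₀ y₀ t₁ + r) ∈ 𝓝 (Yfun t₀ y₀ t₁) := Iio_mem_nhds (by linarith)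
    exact eventually_nhdsWithin_of_eventually_nhds
      (((continuous_Yfun t₀ y₀).tendsto t₁).eventually_mem h3)
  obtain ⟨t, ⟨w, hw, hw0⟩, ht0, htt, hYt⟩ := (hH.and (hev₁.and (hev₂.and hev₃))).exists
  refine hmin t ht0 htt ⟨w, hw0, ?_, ?_, ?_⟩
  · have := abs_re_le_norm (w - z)
    rw [mem_ball, dist_eq_norm] at hw
    rw [sub_re] at this
    linarith [(abs_le.1 (this.trans hw.le)).1]
  · have := abs_re_le_norm (w - z)
    rw [mem_ball, dist_eq_norm] at hw
    rw [sub_re] at this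
    linarith [(abs_le.1 (this.trans hw.le)).2]
  · have := abs_im_le_norm (w - z)
    rw [mem_ball, dist_eq_norm] at hw
    rw [sub_im] at this
    linarith [(abs_le.1 (this.trans hw.le)).1]

/-- **The minimal bad time.** If some `t ∈ [0, t₀]` is bad then there is a minimal bad time
`t₁ ∈ (0, t₀]`; at it, every zero of `H_{t₁}` in `R(t₁)` lies on the lower edge `Im z = Y(t₁)`
with `0 < Re z < X` (left edge: `H_t(iy) > 0`; right edge: the barrier (iii); interior: Hurwitz).
[cite: Polymath2019, Prop. 3.3 (proof)] -/
theorem exists_minimal_bad (h₁ : InitialZeroFreeH t₀ X y₀) (h₃ : BarrierZeroFree t₀ X y₀)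
    (hy₀ : 0 < y₀) {s : ℝ} (hs : s ∈ Icc 0 t₀) (hbad : Bad t₀ X y₀ s) :
    ∃ t₁, 0 < t₁ ∧ t₁ ≤ t₀ ∧ Bad t₀ X y₀ t₁ ∧ (∀ t, 0 ≤ t → t < t₁ → ¬Bad t₀ X y₀ t) ∧
      ∀ z : ℂ, deBruijnH t₁ z = 0 → InRegion t₀ X y₀ t₁ z →
        z.im = Yfun t₀ y₀ t₁ ∧ 0 < z.re ∧ z.re < X := by
  set T : Set ℝ := {t : ℝ | t ∈ Icc 0 t₀ ∧ Bad t₀ X y₀ t} with hT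
  have hTne : T.Nonempty := ⟨s, hs, hbad⟩
  have hTbdd : BddBelow T := ⟨0, fun t ht ↦ ht.1.1⟩
  have hTclosed : IsClosed T := isClosed_badSet
  set t₁ := sInf T with ht₁
  have ht₁T : t₁ ∈ T := hTclosed.csInf_mem hTne hTbdd
  have hmin : ∀ t, 0 ≤ t → t < t₁ → ¬Bad t₀ X y₀ t := fun t ht0 htt hb ↦
    (lt_irrefl t) (htt.trans_le (csInf_le hTbdd ⟨⟨ht0, htt.le.trans ht₁T.1.2⟩, hb⟩))
  have ht₁pos : 0 < t₁ := by
    rcases ht₁T.1.1.eq_or_lt with h | h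
    · exact absurd (h ▸ ht₁T.2) (not_bad_zero h₁)
    · exact h
  refine ⟨t₁, ht₁pos, ht₁T.1.2, ht₁T.2, hmin, fun z hz hR ↦ ?_⟩
  obtain ⟨h0, hX, hY⟩ := hR
  -- left edge
  have hre0 : 0 < z.re := lt_of_le_of_ne h0 (re_ne_zero_of_zero hz).symm
  -- right edge and beyond
  have hreX : z.re < X := by
    refine lt_of_le_of_ne hX fun h ↦ ?_
    exact barrier_excludes h₃ hy₀ ht₁pos ht₁T.1.2 hz h.ge
      (by rw [h]; linarith [Real.sqrt_nonneg (1 - y₀ ^ 2)]) hY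
  -- interior
  have him : z.im = Yfun t₀ y₀ t₁ := by
    refine (eq_or_lt_of_le hY).elim Eq.symm fun hlt ↦ ?_
    exact (not_interior_zero_at_minimal ht₁pos hmin hz hre0 hreX hlt).elim
  exact ⟨him, hre0, hreX⟩

end Barrier

/-! ## The residue of `F''/F` at a zero (rectangle contour) -/

section Residue

open Literature.Analysis.Complex

variable {a b c d : ℝ}

/-- The boundary of a (non-degenerate) rectangle lies in the closed rectangle. [folklore] -/
theorem rectBoundarySet_subset_reProdIm (hab : a ≤ b) (hcd : c ≤ d) :
    rectBoundarySet a b c d ⊆ Icc a b ×ℂ Icc c d := by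
  rintro w ((⟨x, hx, rfl⟩ | ⟨x, hx, rfl⟩) | (⟨y, hy, rfl⟩ | ⟨y, hy, rfl⟩))
  · exact ⟨by simpa using hx, by simpa using left_mem_Icc.2 hcd⟩
  · exact ⟨by simpa using hx, by simpa using right_mem_Icc.2 hcd⟩
  · exact ⟨by simpa using left_mem_Icc.2 hab, by simpa using hy⟩
  · exact ⟨by simpa using right_mem_Icc.2 hab, by simpa using hy⟩

/-- An interior point is not on the boundary. [folklore] -/
theorem ne_of_mem_rectBoundarySet {z₁ : ℂ} (ha : a < z₁.re) (hb : z₁.re < b) (hc : c < z₁.im)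
    (hd : z₁.im < d) {w : ℂ} (hw : w ∈ rectBoundarySet a b c d) : w ≠ z₁ := by
  rintro rfl
  rcases hw with ((⟨x, -, hx⟩ | ⟨x, -, hx⟩) | (⟨y, -, hy⟩ | ⟨y, -, hy⟩))
  · have := congrArg Complex.im hx; simp at this; linarith
  · have := congrArg Complex.im hx; simp at this; linarith
  · have := congrArg Complex.re hy; simp at this; linarith
  · have := congrArg Complex.re hy; simp at this; linarith

/-- `logDeriv ((w − z₁)^m Q) = m/(w − z₁) + logDeriv Q` off `z₁` and off the zeros of `Q`.
[folklore] -/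
theorem logDeriv_pow_mul_eq {Q : ℂ → ℂ} (hQ : Differentiable ℂ Q) (z₁ : ℂ) (m : ℕ) {w : ℂ}
    (hw : w ≠ z₁) (hQw : Q w ≠ 0) :
    logDeriv (fun w ↦ (w - z₁) ^ m * Q w) w = m / (w - z₁) + logDeriv Q w := by
  have hsub : w - z₁ ≠ 0 := sub_ne_zero.2 hw
  rw [logDeriv_mul (f := fun w ↦ (w - z₁) ^ m) (g := Q) w (pow_ne_zero _ hsub) hQw (by fun_prop)
      (hQ w), logDeriv_fun_pow (f := fun w ↦ w - z₁) (by fun_prop)]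
  have : logDeriv (fun w : ℂ ↦ w - z₁) w = 1 / (w - z₁) := by
    rw [logDeriv_apply, deriv_sub_const, deriv_id'']
  rw [this]
  ring

/-- `F''/F = (F'/F)' + (F'/F)²` where `F ≠ 0`. [folklore] -/
theorem deriv_deriv_div_eq {F : ℂ → ℂ} (hF : Differentiable ℂ F) (hF' : Differentiable ℂ (deriv F))
    {w : ℂ} (hw : F w ≠ 0) :
    deriv (deriv F) w / F w = deriv (logDeriv F) w + (logDeriv F w) ^ 2 := by
  have hld : logDeriv F = fun w ↦ deriv F w / F w := by funext w; rw [logDeriv_apply]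
  rw [hld, deriv_fun_div (hF' w) (hF w) hw]
  field_simp
  ring

/-- **`(1/2πi) ∮_{∂K} F''/F = 2m · (Q'/Q)(z₁)`** for `F = (w − z₁)^m Q` with `Q` entire and
zero-free on the closed rectangle `K ∋ z₁` (interior point): `F''/F = (m² − m)/(w − z₁)² +
2m (Q'/Q)/(w − z₁) + ((Q'/Q)' + (Q'/Q)²)`, and the three boundary integrals are `0` (exact
derivative), `2πi · 2m (Q'/Q)(z₁)` (Cauchy) and `0` (Cauchy–Goursat). This is the residue behind
`ż = H''/H'` at a simple zero (Polymath 15, eq. (tzj)), for any multiplicity. [folklore] -/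
theorem rectBoundaryIntegral_deriv_deriv_div {F Q : ℂ → ℂ} {z₁ : ℂ} {m : ℕ}
    (hQ : Differentiable ℂ Q) (hFQ : ∀ w, F w = (w - z₁) ^ m * Q w)
    (ha : a < z₁.re) (hb : z₁.re < b) (hc : c < z₁.im) (hd : z₁.im < d)
    (hQ0 : ∀ w ∈ Icc a b ×ℂ Icc c d, Q w ≠ 0) :
    rectBoundaryIntegral (fun w ↦ deriv (deriv F) w / F w) a b c d =
      2 * Real.pi * I * (2 * m * logDeriv Q z₁) := by
  have hab : a ≤ b := (ha.trans hb).le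
  have hcd : c ≤ d := (hc.trans hd).le
  have hFeq : F = fun w ↦ (w - z₁) ^ m * Q w := funext hFQ
  have hF : Differentiable ℂ F := by rw [hFeq]; fun_prop
  have hbd : ∀ w ∈ rectBoundarySet a b c d, w ≠ z₁ := fun w hw ↦
    ne_of_mem_rectBoundarySet ha hb hc hd hw
  have hF' : Differentiable ℂ (deriv F) := fun w ↦ ((hF.analyticAt w).deriv).differentiableAt
  -- the set where the formula for `logDeriv F` holds is open
  have hUopen : IsOpen {w : ℂ | w ≠ z₁ ∧ Q w ≠ 0} :=
    (isOpen_ne).inter (isOpen_ne.preimage hQ.continuous)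
  have hLQ_an : ∀ w, Q w ≠ 0 → AnalyticAt ℂ (logDeriv Q) w := fun w hw ↦ by
    have : logDeriv Q = fun w ↦ deriv Q w / Q w := by funext w; rw [logDeriv_apply]
    rw [this]
    exact (hQ.analyticAt w).deriv.div (hQ.analyticAt w) hw
  -- boundary points: `w ≠ z₁`, `Q w ≠ 0`, and membership in the closed rectangle
  have hbdK : rectBoundarySet a b c d ⊆ Icc a b ×ℂ Icc c d :=
    rectBoundarySet_subset_reProdIm hab hcd
  -- the pointwise decomposition on the boundary
  have hdec : ∀ w ∈ rectBoundarySet a b c d, deriv (deriv F) w / F w =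
      ((m : ℂ) ^ 2 - m) * (1 / (w - z₁) ^ 2) +
        (2 * m * (logDeriv Q w / (w - z₁)) + (deriv (logDeriv Q) w + logDeriv Q w ^ 2)) := by
    intro w hw
    have hwz : w ≠ z₁ := hbd w hw
    have hQw : Q w ≠ 0 := hQ0 w (hbdK hw)
    have hFw : F w ≠ 0 := by
      rw [hFQ]; exact mul_ne_zero (pow_ne_zero _ (sub_ne_zero.2 hwz)) hQw
    rw [deriv_deriv_div_eq hF hF' hFw]
    -- `logDeriv F = m/(w - z₁) + logDeriv Q` near `w`
    have hev : logDeriv F =ᶠ[𝓝 w] fun w ↦ m / (w - z₁) + logDeriv Q w := by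
      filter_upwards [hUopen.mem_nhds ⟨hwz, hQw⟩] with v hv
      rw [hFeq]
      exact logDeriv_pow_mul_eq hQ z₁ m hv.1 hv.2
    rw [hev.deriv_eq, hev.eq_of_nhds]
    have hd0 : HasDerivAt (fun v : ℂ ↦ v - z₁) 1 w := (hasDerivAt_id w).sub_const z₁
    have hd1 : HasDerivAt (fun v : ℂ ↦ (m : ℂ) / (v - z₁)) (-(m : ℂ) / (w - z₁) ^ 2) w := by
      have h := (hasDerivAt_const w (m : ℂ)).div hd0 (sub_ne_zero.2 hwz)
      refine h.congr_deriv ?_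
      ring
    have hd2 : DifferentiableAt ℂ (logDeriv Q) w := (hLQ_an w hQw).differentiableAt
    rw [deriv_fun_add hd1.differentiableAt hd2, hd1.deriv]
    have hsub : w - z₁ ≠ 0 := sub_ne_zero.2 hwz
    field_simp
    ring
  -- integrate the three pieces
  have hc₁ : ∀ w ∈ rectBoundarySet a b c d,
      ContinuousAt (fun w ↦ ((m : ℂ) ^ 2 - m) * (1 / (w - z₁) ^ 2)) w := fun w hw ↦ by
    have hsub : (w - z₁) ^ 2 ≠ 0 := pow_ne_zero _ (sub_ne_zero.2 (hbd w hw))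
    exact (continuousAt_const.div ((continuousAt_id.sub continuousAt_const).pow 2) hsub).const_mul
      _
  have hc₂₃ : ∀ w ∈ rectBoundarySet a b c d, ContinuousAt (fun w ↦ 2 * m * (logDeriv Q w / (w - z₁))
      + (deriv (logDeriv Q) w + logDeriv Q w ^ 2)) w := fun w hw ↦ by
    have hQw : Q w ≠ 0 := hQ0 w (hbdK hw)
    have hL := (hLQ_an w hQw).continuousAt
    exact ((hL.div (continuousAt_id.sub continuousAt_const) (sub_ne_zero.2 (hbd w hw))).const_mul
      _).add ((hLQ_an w hQw).deriv.continuousAt.add (hL.pow 2))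
  have hc₂ : ∀ w ∈ rectBoundarySet a b c d,
      ContinuousAt (fun w ↦ 2 * m * (logDeriv Q w / (w - z₁))) w := fun w hw ↦ by
    have hQw : Q w ≠ 0 := hQ0 w (hbdK hw)
    exact ((hLQ_an w hQw).continuousAt.div (continuousAt_id.sub continuousAt_const)
      (sub_ne_zero.2 (hbd w hw))).const_mul _
  have hc₃ : ∀ w ∈ rectBoundarySet a b c d,
      ContinuousAt (fun w ↦ deriv (logDeriv Q) w + logDeriv Q w ^ 2) w := fun w hw ↦ by
    have hQw : Q w ≠ 0 := hQ0 w (hbdK hw)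
    exact (hLQ_an w hQw).deriv.continuousAt.add ((hLQ_an w hQw).continuousAt.pow 2)
  have mem_bot : ∀ x ∈ Icc a b, ((x : ℂ) + c * I) ∈ rectBoundarySet a b c d :=
    fun x hx ↦ Or.inl (Or.inl ⟨x, hx, rfl⟩)
  have mem_top : ∀ x ∈ Icc a b, ((x : ℂ) + d * I) ∈ rectBoundarySet a b c d :=
    fun x hx ↦ Or.inl (Or.inr ⟨x, hx, rfl⟩)
  have mem_left : ∀ y ∈ Icc c d, ((a : ℂ) + y * I) ∈ rectBoundarySet a b c d :=
    fun y hy ↦ Or.inr (Or.inl ⟨y, hy, rfl⟩)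
  have mem_right : ∀ y ∈ Icc c d, ((b : ℂ) + y * I) ∈ rectBoundarySet a b c d :=
    fun y hy ↦ Or.inr (Or.inr ⟨y, hy, rfl⟩)
  -- piece 1: exact derivative of `-1/(w - z₁)` times a constant
  have hI₁ : rectBoundaryIntegral (fun w ↦ ((m : ℂ) ^ 2 - m) * (1 / (w - z₁) ^ 2)) a b c d = 0 := by
    rw [rectBoundaryIntegral_const_mul]
    have han : ∀ w ∈ rectBoundarySet a b c d, AnalyticAt ℂ (fun v : ℂ ↦ (-1) / (v - z₁)) w :=
      fun w hw ↦ analyticAt_const.div (analyticAt_id.sub analyticAt_const)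
        (sub_ne_zero.2 (hbd w hw))
    have hder : ∀ w ∈ rectBoundarySet a b c d,
        1 / (w - z₁) ^ 2 = deriv (fun v : ℂ ↦ (-1) / (v - z₁)) w := by
      intro w hw
      have h : HasDerivAt (fun v : ℂ ↦ (-1) / (v - z₁))
          ((0 * (w - z₁) - (-1) * 1) / (w - z₁) ^ 2) w :=
        (hasDerivAt_const w (-1 : ℂ)).div ((hasDerivAt_id w).sub_const z₁)
          (sub_ne_zero.2 (hbd w hw))
      rw [h.deriv]
      ring
    rw [rectBoundaryIntegral_congr (G := deriv (fun v : ℂ ↦ (-1) / (v - z₁))) hab hcd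
      (fun x hx ↦ hder _ (mem_bot x hx)) (fun x hx ↦ hder _ (mem_top x hx))
      (fun y hy ↦ hder _ (mem_left y hy)) (fun y hy ↦ hder _ (mem_right y hy)),
      rectBoundaryIntegral_deriv_eq_zero hab hcd (fun x hx ↦ han _ (mem_bot x hx))
      (fun x hx ↦ han _ (mem_top x hx)) (fun y hy ↦ han _ (mem_left y hy))
      (fun y hy ↦ han _ (mem_right y hy)), mul_zero]
  -- piece 2: Cauchy's integral formula for `logDeriv Q`
  have hI₂ : rectBoundaryIntegral (fun w ↦ 2 * m * (logDeriv Q w / (w - z₁))) a b c d =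
      2 * Real.pi * I * (2 * m * logDeriv Q z₁) := by
    rw [rectBoundaryIntegral_const_mul]
    have hdiff : DifferentiableOn ℂ (logDeriv Q) (Icc a b ×ℂ Icc c d) := fun w hw ↦
      (hLQ_an w (hQ0 w hw)).differentiableAt.differentiableWithinAt
    have h := integral_boundary_rect_div_sub_eq (f := logDeriv Q) z₁ ha hb hc hd hdiff
    rw [rectBoundaryIntegral, h]
    ring
  -- piece 3: Cauchy–Goursat
  have hI₃ :
      rectBoundaryIntegral (fun w ↦ deriv (logDeriv Q) w + logDeriv Q w ^ 2) a b c d = 0 := by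
    refine rectBoundaryIntegral_eq_zero_of_differentiableOn hab hcd fun w hw ↦ ?_
    have hQw := hQ0 w hw
    exact ((hLQ_an w hQw).deriv.differentiableAt.add
      ((hLQ_an w hQw).differentiableAt.pow 2)).differentiableWithinAt
  rw [rectBoundaryIntegral_congr (G := fun w ↦ ((m : ℂ) ^ 2 - m) * (1 / (w - z₁) ^ 2) +
        (2 * m * (logDeriv Q w / (w - z₁)) + (deriv (logDeriv Q) w + logDeriv Q w ^ 2))) hab hcd
      (fun x hx ↦ hdec _ (mem_bot x hx))
      (fun x hx ↦ hdec _ (mem_top x hx)) (fun y hy ↦ hdec _ (mem_left y hy))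
      (fun y hy ↦ hdec _ (mem_right y hy)),
    rectBoundaryIntegral_add hab hcd (fun x hx ↦ hc₁ _ (mem_bot x hx))
      (fun x hx ↦ hc₁ _ (mem_top x hx)) (fun y hy ↦ hc₁ _ (mem_left y hy))
      (fun y hy ↦ hc₁ _ (mem_right y hy)) (fun x hx ↦ hc₂₃ _ (mem_bot x hx))
      (fun x hx ↦ hc₂₃ _ (mem_top x hx)) (fun y hy ↦ hc₂₃ _ (mem_left y hy))
      (fun y hy ↦ hc₂₃ _ (mem_right y hy)),
    rectBoundaryIntegral_add hab hcd (fun x hx ↦ hc₂ _ (mem_bot x hx))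
      (fun x hx ↦ hc₂ _ (mem_top x hx)) (fun y hy ↦ hc₂ _ (mem_left y hy))
      (fun y hy ↦ hc₂ _ (mem_right y hy)) (fun x hx ↦ hc₃ _ (mem_bot x hx))
      (fun x hx ↦ hc₃ _ (mem_top x hx)) (fun y hy ↦ hc₃ _ (mem_left y hy))
      (fun y hy ↦ hc₃ _ (mem_right y hy)),
    hI₁, hI₂, hI₃]
  ring

end Residue

/-! ## The heat-flow family `H_t` satisfies the hypotheses of the variation formula -/

section Family

open Literature.Analysis.Complex

/-- `∂_t H_t'(w) = (∂_t H_t)'(w)`: the mixed partials, both equal to `−S_3(t, w)`.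
[folklore] -/
private theorem family_hf't (t : ℝ) (w : ℂ) :
    HasDerivAt (fun s ↦ deriv (deBruijnH s) w) (deriv (cosMoment 2 t) w) t := by
  rw [(hasDerivAt_cosMoment_two_z t w).deriv]
  exact hasDerivAt_deriv_deBruijnH_time t w

/-- Joint continuity of `(t, w) ↦ (∂_t H_t)'(w) = −S_3(t, w)`. [folklore] -/
private theorem family_hfd'c : Continuous fun p : ℝ × ℂ ↦ deriv (cosMoment 2 p.1) p.2 := by
  have : (fun p : ℝ × ℂ ↦ deriv (cosMoment 2 p.1) p.2) = fun p ↦ -sinMoment 3 p.1 p.2 :=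
    funext fun p ↦ (hasDerivAt_cosMoment_two_z p.1 p.2).deriv
  rw [this]
  exact (continuous_sinMoment_uncurry 3).neg

/-- The multiplicities `m_t(ρ)` of the weighted argument principle are natural numbers (`H_t` is
entire and not identically zero), positive exactly at the zeros. [folklore] -/
theorem exists_nat_order (t : ℝ) (ρ : ℂ) :
    ∃ n : ℕ, analyticOrderAt (deBruijnH t) ρ = n ∧
      ((meromorphicOrderAt (deBruijnH t) ρ).untop₀ : ℂ) = n := by
  have hf := differentiable_deBruijnH_holds t
  have han : AnalyticAt ℂ (deBruijnH t) ρ := hf.analyticAt ρ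
  have hfin : analyticOrderAt (deBruijnH t) ρ ≠ ⊤ := by
    intro htop
    rw [analyticOrderAt_eq_top] at htop
    obtain ⟨z, hz⟩ := exists_deBruijnH_ne_zero t
    exact hz ((hf.differentiableOn.analyticOnNhd
      isOpen_univ).eqOn_zero_of_preconnected_of_eventuallyEq_zero
      isPreconnected_univ (mem_univ ρ) htop (mem_univ z))
  obtain ⟨n, hn⟩ := ENat.ne_top_iff_exists.1 hfin
  refine ⟨n, hn.symm, ?_⟩
  rw [han.meromorphicOrderAt_eq, ← hn]
  rfl

/-- The multiplicity is positive exactly at the zeros. [folklore] -/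
theorem order_pos_iff {t : ℝ} {ρ : ℂ} {n : ℕ} (hn : analyticOrderAt (deBruijnH t) ρ = n) :
    0 < n ↔ deBruijnH t ρ = 0 := by
  have han : AnalyticAt ℂ (deBruijnH t) ρ := (differentiable_deBruijnH_holds t).analyticAt ρ
  rw [← han.analyticOrderAt_ne_zero, hn, pos_iff_ne_zero]
  simp

end Family

/-! ## The contradiction at the minimal bad time -/

section Dynamics

open Literature.Analysis.Complex

variable {t₀ X y₀ : ℝ}

/-- **No minimal bad time** (the heart of Polymath 15, Prop. 3.3, for a boundary zero of any
multiplicity). At a minimal bad time `t₁ > 0` pick a zero `z₁ = x₁ + iY(t₁)` of `H_{t₁}` on the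
lower edge of `R(t₁)`, of multiplicity `m`, and a small rectangle `K` around it. For `t` near `t₁`
the zeros of `H_t` in `K` have total multiplicity `m` and their weighted sum `c(t) = Σ m_t(ρ) ρ` is
differentiable at `t₁` with `ċ(t₁) = (1/2πi) ∮_{∂K} H''/H = 2m (Q'/Q)(z₁)` (variation formula +
backwards heat equation + residue), so `Im ċ(t₁) < −m²/Y(t₁) ≤ m Ẏ(t₁)` by the sign computation;
but for `t < t₁` all these zeros lie below `Im = Y(t)` (minimality), so `Im c(t) < m Y(t)` while
`Im c(t₁) = m Y(t₁)`, forcing `d/dt (Im c − mY)(t₁) ≥ 0` — contradiction.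
[cite: Polymath2019, Prop. 3.3 (proof)] -/
theorem no_minimal_bad (h₃ : BarrierZeroFree t₀ X y₀) (hy₀ : 0 < y₀) (hy₁ : y₀ ≤ 1)
    {t₁ : ℝ} (ht₁ : 0 < t₁) (ht₁₀ : t₁ ≤ t₀)
    (hmin : ∀ t, 0 ≤ t → t < t₁ → ¬Bad t₀ X y₀ t)
    (hedge : ∀ z : ℂ, deBruijnH t₁ z = 0 → InRegion t₀ X y₀ t₁ z →
      z.im = Yfun t₀ y₀ t₁ ∧ 0 < z.re ∧ z.re < X)
    {z₁ : ℂ} (hz₁ : deBruijnH t₁ z₁ = 0) (hR : InRegion t₀ X y₀ t₁ z₁) : False := by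
  obtain ⟨hz_im, hx₁, hx₁X⟩ := hedge z₁ hz₁ hR
  have hY : 0 < Yfun t₀ y₀ t₁ := Yfun_pos hy₀ ht₁₀
  have hYy₀ : y₀ ≤ Yfun t₀ y₀ t₁ := le_Yfun hy₀.le ht₁₀
  have hzY : 0 < z₁.im := by rw [hz_im]; exact hY
  ----------------------------------------------------------------
  -- (a) the other zeros of `H_{t₁}` are far from `z₁`
  ----------------------------------------------------------------
  have hstrip : ∀ ρ : ℂ, deBruijnH t₁ ρ = 0 → |ρ.im| < 1 := fun ρ hρ ↦
    abs_im_lt_one_of_zero ht₁.le hρ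
  have hfar0 : ∀ ρ : ℂ, deBruijnH t₁ ρ = 0 → Yfun t₀ y₀ t₁ < |ρ.im| →
      X + Real.sqrt (1 - y₀ ^ 2) < |ρ.re| := by
    intro ρ hρ hρim
    -- a zero `σ` with `Im σ = |Im ρ|`, `Re σ = |Re ρ|`
    obtain ⟨σ, hσ, hσim, hσre⟩ : ∃ σ : ℂ, deBruijnH t₁ σ = 0 ∧ σ.im = |ρ.im| ∧ σ.re = |ρ.re| := by
      rcases le_or_gt 0 ρ.im with h1 | h1 <;> rcases le_or_gt 0 ρ.re with h2 | h2
      · exact ⟨ρ, hρ, (abs_of_nonneg h1).symm, (abs_of_nonneg h2).symm⟩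
      · exact ⟨-(starRingEnd ℂ ρ), zero_neg_conj hρ, by simp [abs_of_nonneg h1],
          by simp [abs_of_neg h2]⟩
      · exact ⟨starRingEnd ℂ ρ, deBruijnH_conj_eq_zero hρ, by simp [abs_of_neg h1],
          by simp [abs_of_nonneg h2]⟩
      · exact ⟨-ρ, by rw [deBruijnH_neg]; exact hρ, by simp [abs_of_neg h1],
          by simp [abs_of_neg h2]⟩
    rw [← hσre]
    rw [← hσim] at hρim
    have hσre0 : 0 ≤ σ.re := by rw [hσre]; exact abs_nonneg _
    by_contra hle
    rw [not_lt] at hle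
    rcases le_or_gt σ.re X with h | h
    · -- inside `R(t₁)` but above the lower edge
      have := (hedge σ hσ ⟨hσre0, h, hρim.le⟩).1
      linarith
    · exact barrier_excludes h₃ hy₀ ht₁ ht₁₀ hσ h.le hle hρim.le
  have hfar : ∀ ρ : ℂ, deBruijnH t₁ ρ = 0 → z₁.im < |ρ.im| →
      1 - z₁.im ^ 2 ≤ (z₁.re - ρ.re) ^ 2 ∧ 1 - z₁.im ^ 2 ≤ (z₁.re + ρ.re) ^ 2 := by
    intro ρ hρ hρim
    rw [hz_im] at hρim ⊢
    have h := hfar0 ρ hρ hρim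
    have hs : Real.sqrt (1 - y₀ ^ 2) ^ 2 = 1 - y₀ ^ 2 := Real.sq_sqrt (by nlinarith)
    have hs0 : 0 ≤ Real.sqrt (1 - y₀ ^ 2) := Real.sqrt_nonneg _
    have h1 : Real.sqrt (1 - y₀ ^ 2) < |z₁.re - ρ.re| := by
      have := abs_sub_abs_le_abs_sub ρ.re z₁.re
      rw [abs_sub_comm] at this
      rw [abs_of_pos hx₁] at this
      linarith
    have h2 : Real.sqrt (1 - y₀ ^ 2) < |z₁.re + ρ.re| := by
      have h' : |ρ.re| - z₁.re ≤ |z₁.re + ρ.re| := by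
        have := abs_sub_abs_le_abs_sub ρ.re (-z₁.re)
        rw [abs_neg, abs_of_pos hx₁, sub_neg_eq_add, add_comm] at this
        exact this
      linarith
    have hY2 : y₀ ^ 2 ≤ Yfun t₀ y₀ t₁ ^ 2 := pow_le_pow_left₀ hy₀.le hYy₀ 2
    have h1' := pow_lt_pow_left₀ h1 hs0 two_ne_zero
    have h2' := pow_lt_pow_left₀ h2 hs0 two_ne_zero
    rw [hs, sq_abs] at h1' h2'
    constructor <;> linarith
  ----------------------------------------------------------------
  -- Hadamard data at `z₁`: multiplicity `m`, cofactor `Q`, the sign computation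
  ----------------------------------------------------------------
  obtain ⟨bseq, hb⟩ := exists_isHadamardSeq t₁
  set m : ℕ := hb.mult z₁ with hm_def
  have hm : 0 < m := hb.mult_pos hz₁
  set Q : ℂ → ℂ := hb.cofactor z₁ with hQ_def
  have hfacQ : ∀ w, deBruijnH t₁ w = (w - z₁) ^ m * Q w := hb.eq_pow_mul_cofactor hz₁
  have hQd : Differentiable ℂ Q := hb.differentiable_cofactor z₁
  have hQ0 : Q z₁ ≠ 0 := hb.cofactor_self_ne_zero hz₁
  have hL : (logDeriv Q z₁).im < -m / (2 * z₁.im) :=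
    im_logDeriv_cofactor_lt hx₁ hzY hz₁ hstrip (fun ρ hρ h ↦ (hfar ρ hρ h).1) (hQd.analyticAt z₁)
      hQ0 (Eventually.of_forall hfacQ)
  ----------------------------------------------------------------
  -- (b) an isolating rectangle `K = [a,b] × [c,d]` around `z₁` inside `{0 < Re < X, Im > 0}`
  ----------------------------------------------------------------
  have hiso : ∀ᶠ w in 𝓝[≠] z₁, deBruijnH t₁ w ≠ 0 := by
    rcases ((differentiable_deBruijnH_holds t₁).analyticAt
      z₁).eventually_eq_zero_or_eventually_ne_zero with h | h
    · exfalso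
      obtain ⟨w₀, hw₀⟩ := exists_deBruijnH_ne_zero t₁
      have hall := ((differentiable_deBruijnH_holds t₁).differentiableOn.analyticOnNhd
        isOpen_univ).eqOn_zero_of_preconnected_of_eventuallyEq_zero isPreconnected_univ
        (mem_univ z₁) h
      exact hw₀ (hall (mem_univ w₀))
    · exact h
  obtain ⟨r₀, hr₀, hiso'⟩ : ∃ r₀ > 0, ∀ w, dist w z₁ < r₀ → w ≠ z₁ → deBruijnH t₁ w ≠ 0 := by
    rw [eventually_nhdsWithin_iff, Metric.eventually_nhds_iff] at hiso
    obtain ⟨r₀, hr₀, h⟩ := hiso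
    exact ⟨r₀, hr₀, fun w hw hne ↦ h hw hne⟩
  set r : ℝ := min (min z₁.re (X - z₁.re)) (min z₁.im r₀) / 4 with hr
  have hr_pos : 0 < r := by
    have : 0 < min (min z₁.re (X - z₁.re)) (min z₁.im r₀) :=
      lt_min (lt_min hx₁ (by linarith)) (lt_min hzY hr₀)
    rw [hr]; linarith
  have hr1 : 4 * r ≤ z₁.re := by
    rw [hr]
    linarith [min_le_left (min z₁.re (X - z₁.re)) (min z₁.im r₀), min_le_left z₁.re (X - z₁.re)]
  have hr2 : 4 * r ≤ X - z₁.re := by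
    rw [hr]
    linarith [min_le_left (min z₁.re (X - z₁.re)) (min z₁.im r₀), min_le_right z₁.re (X - z₁.re)]
  have hr3 : 4 * r ≤ z₁.im := by
    rw [hr]; linarith [min_le_right (min z₁.re (X - z₁.re)) (min z₁.im r₀), min_le_left z₁.im r₀]
  have hr4 : 4 * r ≤ r₀ := by
    rw [hr]; linarith [min_le_right (min z₁.re (X - z₁.re)) (min z₁.im r₀), min_le_right z₁.im r₀]
  set a : ℝ := z₁.re - r with ha_def
  set b : ℝ := z₁.re + r with hb_def
  set c : ℝ := z₁.im - r with hc_def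
  set d : ℝ := z₁.im + r with hd_def
  have hab : a < b := by rw [ha_def, hb_def]; linarith
  have hcd : c < d := by rw [hc_def, hd_def]; linarith
  have ha : a < z₁.re := by rw [ha_def]; linarith
  have hb' : z₁.re < b := by rw [hb_def]; linarith
  have hc : c < z₁.im := by rw [hc_def]; linarith
  have hd' : z₁.im < d := by rw [hd_def]; linarith
  have ha0 : 0 < a := by rw [ha_def]; linarith
  have hbX : b < X := by rw [hb_def]; linarith
  have hc0 : 0 < c := by rw [hc_def]; linarith
  -- points of the closed rectangle are within `r₀` of `z₁`
  have hKdist : ∀ w ∈ Icc a b ×ℂ Icc c d, dist w z₁ < r₀ := by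
    intro w hw
    obtain ⟨⟨hwa, hwb⟩, ⟨hwc, hwd⟩⟩ := hw
    rw [dist_eq_norm]
    have hre : |(w - z₁).re| ≤ r := by
      rw [sub_re, abs_le]; constructor <;> [rw [ha_def] at hwa; rw [hb_def] at hwb] <;> linarith
    have him : |(w - z₁).im| ≤ r := by
      rw [sub_im, abs_le]; constructor <;> [rw [hc_def] at hwc; rw [hd_def] at hwd] <;> linarith
    have := norm_le_abs_re_add_abs_im (w - z₁)
    linarith
  have hKzero : ∀ w ∈ Icc a b ×ℂ Icc c d, deBruijnH t₁ w = 0 → w = z₁ := fun w hw h0 ↦ by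
    by_contra hne; exact hiso' w (hKdist w hw) hne h0
  have hQK : ∀ w ∈ Icc a b ×ℂ Icc c d, Q w ≠ 0 := by
    intro w hw hQw
    have h0 : deBruijnH t₁ w = 0 := by rw [hfacQ, hQw, mul_zero]
    have := hKzero w hw h0
    rw [this] at hQw
    exact hQ0 hQw
  have hbdK : rectBoundarySet a b c d ⊆ Icc a b ×ℂ Icc c d :=
    rectBoundarySet_subset_reProdIm hab.le hcd.le
  have hbdz : ∀ w ∈ rectBoundarySet a b c d, w ≠ z₁ := fun w hw ↦
    ne_of_mem_rectBoundarySet ha hb' hc hd' hw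
  have h0bd : ∀ w ∈ rectBoundarySet a b c d, deBruijnH t₁ w ≠ 0 := fun w hw h0 ↦
    hbdz w hw (hKzero w (hbdK hw) h0)
  ----------------------------------------------------------------
  -- (c) the variation formula and local constancy of the count
  ----------------------------------------------------------------
  have hfd : ∀ t, Differentiable ℂ (cosMoment 2 t) := fun t w ↦
    (hasDerivAt_cosMoment_z 2 t w).differentiableAt
  obtain ⟨δ, hδ, hnear⟩ := exists_rectBoundaryIntegral_logDeriv_eq_nhds (f := deBruijnH)
    (fd := fun t w ↦ cosMoment 2 t w) (t₁ := t₁) hab.le hcd.le hasDerivAt_deBruijnH_time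
    family_hf't continuous_deBruijnH_uncurry continuous_deriv_deBruijnH_uncurry
    (continuous_cosMoment_uncurry 2) family_hfd'c differentiable_deBruijnH_holds hfd h0bd
  have hvar := hasDerivAt_rectBoundaryIntegral_logDeriv_mul (f := deBruijnH)
    (fd := fun t w ↦ cosMoment 2 t w) (g := fun w : ℂ ↦ w) (t₁ := t₁) hab.le hcd.le
    hasDerivAt_deBruijnH_time family_hf't continuous_deBruijnH_uncurry
    continuous_deriv_deBruijnH_uncurry (continuous_cosMoment_uncurry 2) family_hfd'c
    (differentiable_deBruijnH_holds t₁) (hfd t₁) differentiable_id h0bd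
  -- the value of the derivative: `(1/2πi)∮ H''/H = 2m Q'/Q(z₁)`
  have hD : -rectBoundaryIntegral
      (fun w ↦ cosMoment 2 t₁ w / deBruijnH t₁ w * deriv (fun w : ℂ ↦ w) w) a b c d =
      2 * Real.pi * I * (2 * m * logDeriv Q z₁) := by
    have e : (fun w ↦ cosMoment 2 t₁ w / deBruijnH t₁ w * deriv (fun w : ℂ ↦ w) w) =
        fun w ↦ (-1) * (deriv (deriv (deBruijnH t₁)) w / deBruijnH t₁ w) := by
      funext w
      rw [deriv_id'', mul_one, deriv_deriv_deBruijnH]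
      ring
    rw [e, rectBoundaryIntegral_const_mul, neg_mul, one_mul, neg_neg]
    exact rectBoundaryIntegral_deriv_deriv_div hQd hfacQ ha hb' hc hd' hQK
  rw [hD] at hvar
  ----------------------------------------------------------------
  -- (d) the weighted zero sums
  ----------------------------------------------------------------
  -- multiplicities as natural numbers
  choose nord hnord hμ using fun t ρ ↦ exists_nat_order t ρ
  -- the zero set in the open rectangle
  set Z : ℝ → Set ℂ := fun t ↦ {ρ : ℂ | deBruijnH t ρ = 0 ∧ ρ ∈ Ioo a b ×ℂ Ioo c d} with hZ
  have hcorner : ((a : ℂ) + c * I) ∈ Icc a b ×ℂ Icc c d :=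
    ⟨by simpa using hab.le, by simpa using hcd.le⟩
  have hcorner_bd : ((a : ℂ) + c * I) ∈ rectBoundarySet a b c d :=
    Or.inl (Or.inl ⟨a, left_mem_Icc.2 hab.le, rfl⟩)
  have hZfin : ∀ t, |t - t₁| ≤ δ → (Z t).Finite := fun t ht ↦
    finite_zeros_reProdIm hab.le hcd.le
      ((differentiable_deBruijnH_holds t).differentiableOn.analyticOnNhd isOpen_univ |>.mono
        (subset_univ _)) hcorner ((hnear t ht).1 _ hcorner_bd)
  -- the weighted argument principle for `g = 1` and `g = id`
  have hWAP : ∀ t, |t - t₁| ≤ δ → ∀ g : ℂ → ℂ, Differentiable ℂ g →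
      rectBoundaryIntegral (fun w ↦ deriv (deBruijnH t) w / deBruijnH t w * g w) a b c d =
        2 * Real.pi * I * ∑ᶠ ρ ∈ Z t, (nord t ρ : ℂ) * g ρ := by
    intro t ht g hg
    rw [rectBoundaryIntegral_logDeriv_mul_eq_finsum hab hcd
      ((differentiable_deBruijnH_holds t).differentiableOn.analyticOnNhd isOpen_univ |>.mono
        (subset_univ _)) (hg.differentiableOn.analyticOnNhd isOpen_univ |>.mono (subset_univ _))
      (hnear t ht).1]
    congr 1
    exact finsum_mem_congr rfl fun ρ _ ↦ by rw [hμ]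
  -- at `t₁`: the only zero in `K` is `z₁`, of multiplicity `m`
  have hZ₁ : Z t₁ = {z₁} := by
    ext ρ
    simp only [hZ, mem_setOf_eq, mem_singleton_iff]
    constructor
    · rintro ⟨h0, hρ⟩
      exact hKzero ρ ⟨Ioo_subset_Icc_self hρ.1, Ioo_subset_Icc_self hρ.2⟩ h0
    · rintro rfl
      exact ⟨hz₁, ⟨by simpa using And.intro ha hb', by simpa using And.intro hc hd'⟩⟩
  have hn₁ : nord t₁ z₁ = m := by
    have h1 := hnord t₁ z₁
    rw [hb.analyticOrderAt_eq_mult hz₁] at h1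
    exact_mod_cast h1.symm
  have ht₁δ : |t₁ - t₁| ≤ δ := by simp [hδ.le]
  -- the count is `m` near `t₁`
  have hcount : ∀ t, |t - t₁| ≤ δ → ∑ᶠ ρ ∈ Z t, (nord t ρ : ℂ) = m := by
    intro t ht
    have h1 := hWAP t ht (fun _ ↦ 1) (differentiable_const _)
    have h2 := hWAP t₁ ht₁δ (fun _ ↦ 1) (differentiable_const _)
    simp only [mul_one] at h1 h2
    rw [(hnear t ht).2] at h1
    rw [h1, hZ₁, finsum_mem_singleton, hn₁] at h2
    have hπ : (2 * Real.pi * I : ℂ) ≠ 0 := by simp [Real.pi_ne_zero, I_ne_zero]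
    exact mul_left_cancel₀ hπ h2
  -- the weighted sum of the zeros
  set csum : ℝ → ℂ := fun t ↦ ∑ᶠ ρ ∈ Z t, (nord t ρ : ℂ) * ρ with hcsum
  have hcsum₁ : csum t₁ = m * z₁ := by
    simp only [hcsum, hZ₁, finsum_mem_singleton, hn₁]
  have hcsum_eq : ∀ t, |t - t₁| ≤ δ → csum t = (2 * Real.pi * I)⁻¹ *
      rectBoundaryIntegral (fun w ↦ deriv (deBruijnH t) w / deBruijnH t w * w) a b c d := by
    intro t ht
    rw [hWAP t ht (fun w ↦ w) differentiable_id, ← mul_assoc, inv_mul_cancel₀, one_mul]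
    simp [Real.pi_ne_zero, I_ne_zero]
  have hcsum_deriv :
      HasDerivAt csum ((2 * Real.pi * I)⁻¹ * (2 * Real.pi * I * (2 * m * logDeriv Q z₁))) t₁ := by
    have hev : csum =ᶠ[𝓝 t₁] fun t ↦ (2 * Real.pi * I)⁻¹ *
        rectBoundaryIntegral (fun w ↦ deriv (deBruijnH t) w / deBruijnH t w * w) a b c d := by
      filter_upwards [Metric.closedBall_mem_nhds t₁ hδ] with t ht
      exact hcsum_eq t (by rwa [Metric.mem_closedBall, Real.dist_eq] at ht)
    exact (hvar.const_mul _).congr_of_eventuallyEq hev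
  have hcsum_deriv' : HasDerivAt csum (2 * m * logDeriv Q z₁) t₁ := by
    have hπ : (2 * Real.pi * I : ℂ) ≠ 0 := by simp [Real.pi_ne_zero, I_ne_zero]
    have := hcsum_deriv
    rwa [← mul_assoc, inv_mul_cancel₀ hπ, one_mul] at this
  ----------------------------------------------------------------
  -- (e) left of `t₁` the zeros in `K` lie below `Im = Y(t)`
  ----------------------------------------------------------------
  have hbelow : ∀ t, 0 ≤ t → t < t₁ → |t - t₁| ≤ δ → (csum t).im < m * Yfun t₀ y₀ t := by
    intro t ht0 htt ht
    have hfin := hZfin t ht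
    have hsumeq : csum t = ∑ ρ ∈ hfin.toFinset, (nord t ρ : ℂ) * ρ :=
      finsum_mem_eq_finite_toFinset_sum _ hfin
    have hcnt : ∑ ρ ∈ hfin.toFinset, (nord t ρ : ℂ) = m := by
      rw [← finsum_mem_eq_finite_toFinset_sum _ hfin]; exact hcount t ht
    have hcnt' : ∑ ρ ∈ hfin.toFinset, nord t ρ = m := by exact_mod_cast hcnt
    -- every zero in `K°` lies strictly below `Y(t)` (minimality)
    have hlt : ∀ ρ ∈ hfin.toFinset, ρ.im < Yfun t₀ y₀ t := by
      intro ρ hρ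
      rw [Set.Finite.mem_toFinset] at hρ
      obtain ⟨h0, ⟨hρa, hρb⟩, -⟩ := hρ
      by_contra hge
      rw [not_lt] at hge
      exact hmin t ht0 htt ⟨ρ, h0, by linarith, by linarith, hge⟩
    have him_sum : (csum t).im = ∑ ρ ∈ hfin.toFinset, (nord t ρ : ℝ) * ρ.im := by
      rw [hsumeq, Complex.im_sum]
      refine Finset.sum_congr rfl fun ρ _ ↦ ?_
      simp
    rw [him_sum]
    -- some zero has positive multiplicity
    obtain ⟨ρ₀, hρ₀, hpos⟩ : ∃ ρ ∈ hfin.toFinset, 0 < nord t ρ := by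
      by_contra hno
      push Not at hno
      have : ∑ ρ ∈ hfin.toFinset, nord t ρ = 0 :=
        Finset.sum_eq_zero fun ρ hρ ↦ Nat.le_zero.1 (hno ρ hρ)
      omega
    calc ∑ ρ ∈ hfin.toFinset, (nord t ρ : ℝ) * ρ.im
        < ∑ ρ ∈ hfin.toFinset, (nord t ρ : ℝ) * Yfun t₀ y₀ t := by
          apply Finset.sum_lt_sum
          · intro ρ hρ
            exact mul_le_mul_of_nonneg_left (hlt ρ hρ).le (Nat.cast_nonneg _)
          · exact ⟨ρ₀, hρ₀, mul_lt_mul_of_pos_left (hlt ρ₀ hρ₀) (by exact_mod_cast hpos)⟩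
      _ = m * Yfun t₀ y₀ t := by
          rw [← Finset.sum_mul]
          congr 1
          exact_mod_cast hcnt'
  ----------------------------------------------------------------
  -- (f) `g(t) = Im c(t) − m Y(t)` has `g(t₁) = 0`, `g < 0` just left of `t₁`, but `g'(t₁) < 0`
  ----------------------------------------------------------------
  set gfun : ℝ → ℝ := fun t ↦ (csum t).im - m * Yfun t₀ y₀ t with hg_def
  have hg₁ : gfun t₁ = 0 := by
    show (csum t₁).im - m * Yfun t₀ y₀ t₁ = 0
    rw [hcsum₁, ← hz_im]
    simp
  have hgderiv : HasDerivAt gfun ((2 * m * logDeriv Q z₁).im - m * (-1 / Yfun t₀ y₀ t₁)) t₁ := by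
    have h1 : HasDerivAt (fun t ↦ (csum t).im) ((2 * m * logDeriv Q z₁).im) t₁ :=
      Complex.imCLM.hasFDerivAt.comp_hasDerivAt t₁ hcsum_deriv'
    have h2 : HasDerivAt (fun t ↦ (m : ℝ) * Yfun t₀ y₀ t) (m * (-1 / Yfun t₀ y₀ t₁)) t₁ :=
      (hasDerivAt_Yfun hy₀ ht₁₀).const_mul (m : ℝ)
    exact h1.sub h2
  have hgneg : (2 * m * logDeriv Q z₁).im - m * (-1 / Yfun t₀ y₀ t₁) < 0 := by
    have e : (2 * (m : ℂ) * logDeriv Q z₁).im = 2 * m * (logDeriv Q z₁).im := by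
      simp [Complex.mul_im]
    rw [e, ← hz_im]
    have hm1 : (1 : ℝ) ≤ m := by exact_mod_cast hm
    have h1 : 2 * (m : ℝ) * (logDeriv Q z₁).im < 2 * m * (-(m : ℝ) / (2 * z₁.im)) :=
      mul_lt_mul_of_pos_left hL (by positivity)
    have h2 : 2 * (m : ℝ) * (-(m : ℝ) / (2 * z₁.im)) = -(m * (m / z₁.im)) := by ring
    have h3 : (m : ℝ) / z₁.im ≤ m * (m / z₁.im) :=
      le_mul_of_one_le_left (div_nonneg (Nat.cast_nonneg _) hzY.le) hm1
    have h4 : (m : ℝ) * (-1 / z₁.im) = -(m / z₁.im) := by ring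
    rw [h4]
    linarith
  -- slopes from the left are eventually negative ...
  have hslope : ∀ᶠ t in 𝓝[<] t₁, slope gfun t₁ t < 0 := by
    have h := (hasDerivAt_iff_tendsto_slope.1 hgderiv).eventually_mem (Iio_mem_nhds hgneg)
    exact h.filter_mono (nhdsWithin_mono _ fun t ht ↦ ne_of_lt ht)
  -- ... but `g(t) < 0 = g(t₁)` for `t < t₁` close to `t₁` makes them positive
  have hev₁ : ∀ᶠ t in 𝓝[<] t₁, 0 ≤ t :=
    eventually_nhdsWithin_of_eventually_nhds (eventually_ge_nhds ht₁)
  have hev₂ : ∀ᶠ t in 𝓝[<] t₁, t < t₁ := self_mem_nhdsWithin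
  have hev₃ : ∀ᶠ t in 𝓝[<] t₁, |t - t₁| ≤ δ := by
    have : ∀ᶠ t in 𝓝 t₁, |t - t₁| ≤ δ := by
      filter_upwards [Metric.closedBall_mem_nhds t₁ hδ] with t ht
      rwa [Metric.mem_closedBall, Real.dist_eq] at ht
    exact eventually_nhdsWithin_of_eventually_nhds this
  obtain ⟨t, hst, ht0, htt, htδ⟩ := (hslope.and (hev₁.and (hev₂.and hev₃))).exists
  have hgt : gfun t < 0 := by
    have := hbelow t ht0 htt htδ
    simp only [hg_def]
    linarith
  rw [slope_def_field, hg₁, sub_zero] at hst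
  have : 0 < gfun t / (t - t₁) := div_pos_of_neg_of_neg hgt (by linarith)
  linarith

end Dynamics

/-! ## Proposition 3.3 and Theorem 1.2 -/

section Main

variable {t₀ X y₀ : ℝ}

/-- **Claim A**: no time in `[0, t₀]` is bad. [cite: Polymath2019, Prop. 3.3 (proof)] -/
theorem not_bad (h₁ : InitialZeroFreeH t₀ X y₀) (h₃ : BarrierZeroFree t₀ X y₀)
    (hy₀ : 0 < y₀) (hy₁ : y₀ ≤ 1) {t : ℝ} (ht : t ∈ Icc 0 t₀) : ¬Bad t₀ X y₀ t := by
  intro hbad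
  obtain ⟨t₁, ht₁, ht₁₀, ⟨z₁, hz₁, hR⟩, hmin, hedge⟩ := exists_minimal_bad h₁ h₃ hy₀ ht hbad
  exact no_minimal_bad h₃ hy₀ hy₁ ht₁ ht₁₀ hmin hedge hz₁ hR

/-- **Discharge of `Literature.NumberTheory.LFunctions.Polymath15.zero_free_region_criterion`** (Polymath 15, Prop. 3.3).
[cite: Polymath2019, Prop. 3.3] -/
theorem zero_free_region_criterion_holds : zero_free_region_criterion := by
  intro t₀ X y₀ ht₀ _hX hy₀ hy₁ h₁ h₂ h₃ x y hy hzero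
  -- reflect to `x ≥ 0`
  wlog hx : 0 ≤ x generalizing x
  · have hz' : deBruijnH t₀ ((-x : ℝ) + y * I) = 0 := by
      have := zero_neg_conj hzero
      convert this using 2
      apply Complex.ext <;> simp
    exact this (-x) hz' (by linarith)
  have hy₀y : 0 < y := hy₀.trans_le hy
  rcases le_or_gt x X with hxX | hxX
  · -- inside `[0, X]`: this is `Bad t₀`
    refine not_bad h₁ h₃ hy₀ hy₁ ⟨ht₀.le, le_rfl⟩ ⟨x + y * I, hzero, ?_, ?_, ?_⟩
    · simpa using hx
    · simpa using hxX
    · have e1 : Yfun t₀ y₀ t₀ = y₀ := Yfun_self hy₀.le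
      have e2 : ((x : ℂ) + y * I).im = y := by simp
      rw [e1, e2]
      exact hy
  rcases le_or_gt x (X + Real.sqrt (1 - y₀ ^ 2)) with hxb | hxb
  · -- in the barrier at time `t₀`
    have hcap : y ≤ Real.sqrt (1 - 2 * t₀) := by
      have := im_le_sqrt_of_zero ht₀ hzero (by simpa using hy₀y)
      simpa using this
    exact h₃ t₀ x y ht₀.le le_rfl hxX.le hxb
      (by rw [sub_self, mul_zero, add_zero, Real.sqrt_sq hy₀.le]; exact hy) hcap hzero
  · -- beyond the barrier: hypothesis (ii)
    have hcap : y ≤ Real.sqrt (1 - 2 * t₀) := by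
      have := im_le_sqrt_of_zero ht₀ hzero (by simpa using hy₀y)
      simpa using this
    exact h₂ x y hxb.le hy hcap hzero

/-- **Discharge of `Literature.NumberTheory.LFunctions.Polymath15.upper_bound_criterion`** (Polymath 15, Thm. 1.2).
[cite: Polymath2019, Thm. 1.2] -/
theorem upper_bound_criterion_holds : upper_bound_criterion :=
  upper_bound_criterion_of_zero_free_region_criterion zero_free_region_criterion_holds

end Main

end Polymath15

/-- **Platt–Trudgian 2021, Cor. 2 (`Λ ≤ 0.2`) from its two computational inputs**: with Polymath 15,
Thm. 1.2 now proved (`Polymath15.upper_bound_criterion_holds`), `Literature.NumberTheory.LFunctions.platt_trudgian` follows from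
F1 = `RH.platt_trudgian_numerical_rh` (RH verified to height `3·10¹²`, Platt–Trudgian Thm. 1) and
F3 = `Polymath15.table1_row2` (the barrier computation of Polymath 15, §10, Table 1, row 2).
[cite: PlattTrudgianBLMS2021, Cor. 2] -/
theorem platt_trudgian_of_numerics (h₁ : LFunctions.platt_trudgian_numerical_rh)
    (h₃ : Polymath15.table1_row2) : LFunctions.platt_trudgian :=
  LFunctions.platt_trudgian_of_polymath15 h₁ Polymath15.upper_bound_criterion_holds h₃

end Literature.NumberTheory.LFunctions

end
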